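import Summits.QuantumFields.BalabanUV.T4Continuum.Support.DirichletMorreyDecaySolExt
import Summits.QuantumFields.BalabanUV.T4Continuum.Support.DirichletMonotoneCutoff

/-!
# `BalabanUV.T4Continuum.Support.DirichletVertexCubes` — NE2 (node U1a) formalisation swarm, sub-row `T4-U1a.S-NE2-D1-DIRICHLET°`, supplier item
# «Δ1-SKELETON» (file 14): VERTEX CUBES — the sites within sup-distance `r` of a block-lattice vertex `up β′` (read off `blockOf`/`offsF`) are
# charted by gen 6's Morrey cube `chart (shift (2K − 2m) (cornerBase β′ K))` of side `4m`, bonds included (`r + 2 ≤ 2m`), so that a local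
# energy sum over that neighbourhood is dominated by the charted Dirichlet form `n²·dirOn univ (z ∘ chart)` — the quantity gen 6's
# `morrey_decay_blockReg` / `local_energy_decay_solExt` make decay (unit b2b-balaban-t4-ne2-formalise-leaf-08, gen 7, file 14)

HONEST FRAMING.  Lattice geometry at MODEL level (finite torus `Tor (fine n M)`); [folklore]; NE2 (U1a) is NOT proved by this file; spine PROVED
0/9 unchanged; NOT infinite volume, NOT the mass gap, NOT Clay.  HONEST DEPENDENCY (verbatim): «continuum YM on T⁴ ⇐ BetaPertH ∧ nine spine
estimates (0/9 proved); BetaPertH ⇐ (D1) ∧ (D4) ∧ CAP+tail; G-an2-4 gates asym, D1 and NE2/3/4.»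

WHAT THIS FILE PROVES (0 sorry).  `NearVtx r β′ y` ([shape] data predicate), `vtxBase`, `vtxIdx` (data), `apply_eq_upHom_add`, `upHom_one`,
**`chart_vtxIdx`** (the chart hits every near-vertex site), `vtxIdx_ne_last`, `nearVtx_mono`, and the END **`sum_nearVtx_le_dirOn`**:
`Σ_ν Σ_{x : NearVtx r β′ x} ‖(∂_ν z)(x)‖² ≤ n²·dirOn univ (z ∘ chart (vtxBase m K β′))` (`r + 2 ≤ 2m ≤ 2K`, `4m ≤ n`).

ABSOLUTE RULE (cell, verbatim): «No internally-minted statement may enter as a cited fact. Every hypothesis is either kernel-proved in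
this package or a verbatim quotation of a PUBLISHED theorem with page reference. The manuscript(s) under audit are NOT citable for
their own disputed steps — they are the thing under adjudication; programme-internal (2001/route/tribunal) claims are never citable.»
[folklore]; no `def … : Prop` fact (one [shape] data predicate with parameters).  NOT CLAIMED: any decay, NE2, NE3.
-/

noncomputable section

open scoped BigOperators ComplexConjugate Matrix
open Finset

namespace Summit.QuantumFields.BalabanUV.T4Continuum.DirichletVertexCubes

open Literature.MathematicalPhysics.QuantumFieldTheory.Balaban1983to89.B5Prop11Plancherel (Tor fine unitVec)
open Literature.MathematicalPhysics.QuantumFieldTheory.Balaban1983to89.B5Action121 (sdiff)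
open Literature.MathematicalPhysics.QuantumFieldTheory.Balaban1983to89.B5Block118 (bpt up upHom iota upHom_intCast)
open Literature.MathematicalPhysics.QuantumFieldTheory.Balaban1983to89.B5Blocks16 (blockOf)
open Summit.QuantumFields.BalabanUV.T4Continuum.DirichletMonotoneCutoff (offsF bpt_blockOf_offsF)
open Summit.QuantumFields.BalabanUV.T4Continuum.CoordSlabPoincare (dirOn)
open Summit.QuantumFields.BalabanUV.T4Continuum.DirichletHoleFillingCutoff (chart chart_injective)
open Summit.QuantumFields.BalabanUV.T4Continuum.DirichletMorreyDecay (shift)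
open Summit.QuantumFields.BalabanUV.T4Continuum.DirichletMorreyDecayBlock (cornerBase)
open Summit.QuantumFields.BalabanUV.T4Continuum.DirichletMorreyDecaySolExt (normSq_mul_dirOn_eq)

variable {d : ℕ} (n : ℕ) [NeZero n] (M : Fin d → ℕ) [hM : ∀ μ, NeZero (M μ)]

/-- [shape] `y` lies within `r` of the block-lattice vertex `up β′` (the lower corner of the block `β′`): along every axis either in the block
`β′ ν` with offset `< r`, or in the block `β′ ν − 1` with offset `≥ n − r`. [folklore] -/
def NearVtx (r : ℕ) (β' : Tor M) (y : Tor (fine n M)) : Prop :=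
  ∀ ν, (blockOf n M y ν = β' ν ∧ (offsF n M y ν : ℕ) < r) ∨ (blockOf n M y ν = β' ν - 1 ∧ n ≤ (offsF n M y ν : ℕ) + r)

/-- the base point of the vertex cube of side `4m` inside gen 6's Morrey chart of side `4K`. [folklore] -/
def vtxBase (m K : ℕ) (β' : Tor M) : Tor (fine n M) := shift (fine n M) (2 * K - 2 * m) (cornerBase n M β' K)

/-- the cube coordinate of a site, read off its offset (`< 2m`: upper half `2m + offs`; `≥ 2m`: lower half `2m + offs − n`). [folklore] -/
def vtxIdx (m : ℕ) {n₀ : ℕ} (hn₀ : 4 * m = n₀ + 1) (y : Tor (fine n M)) : Fin d → Fin (n₀ + 1) := fun ν =>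
  ⟨if (offsF n M y ν : ℕ) < 2 * m then 2 * m + (offsF n M y ν : ℕ) else 2 * m + (offsF n M y ν : ℕ) - n, by
    have := (offsF n M y ν).isLt
    split_ifs <;> omega⟩

section Chart

variable {n M}

/-- a site read through its block and offset: `y ν = upHom ν (blockOf y ν) + offsF y ν`. [folklore] -/
theorem apply_eq_upHom_add (y : Tor (fine n M)) (ν : Fin d) :
    y ν = upHom n M ν (blockOf n M y ν) + ((offsF n M y ν : ℕ) : ZMod (fine n M ν)) := by
  conv_lhs => rw [← bpt_blockOf_offsF n M y]
  simp only [bpt, up, iota, Pi.add_apply]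

omit [NeZero n] hM in
/-- `upHom ν 1 = n`. [folklore] -/
theorem upHom_one (ν : Fin d) : upHom n M ν 1 = (n : ZMod (fine n M ν)) := by
  have h := upHom_intCast n M ν 1
  simp only [Int.cast_one, mul_one] at h
  exact h

/-- monotonicity of `NearVtx` in the radius. [folklore] -/
theorem nearVtx_mono {r r' : ℕ} (hr : r ≤ r') {β' : Tor M} {y : Tor (fine n M)} (h : NearVtx n M r β' y) : NearVtx n M r' β' y := by
  intro ν
  rcases h ν with ⟨hb, ho⟩ | ⟨hb, ho⟩
  · exact Or.inl ⟨hb, by omega⟩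
  · exact Or.inr ⟨hb, by omega⟩

/-- **the chart hits every near-vertex site**: `chart (vtxBase m K β′) (vtxIdx m y) = y` (`r ≤ 2m ≤ 2K`, `4m ≤ n`). [folklore] -/
theorem chart_vtxIdx {m K : ℕ} (hmK : m ≤ K) (h4m : 4 * m ≤ n) {n₀ : ℕ} (hn₀ : 4 * m = n₀ + 1) {r : ℕ} (hr : r ≤ 2 * m)
    {β' : Tor M} {y : Tor (fine n M)} (hy : NearVtx n M r β' y) :
    chart (fine n M) (vtxBase n M m K β') (vtxIdx n M m hn₀ y) = y := by
  funext ν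
  simp only [chart, vtxBase, shift, cornerBase, up, Pi.add_apply, Pi.sub_apply, vtxIdx]
  rw [apply_eq_upHom_add y ν]
  have hoff := (offsF n M y ν).isLt
  have h2 : 2 * m ≤ 2 * K := by omega
  rcases hy ν with ⟨hb, ho⟩ | ⟨hb, ho⟩
  · have hlt : (offsF n M y ν : ℕ) < 2 * m := by omega
    rw [if_pos hlt, hb]
    push_cast [Nat.cast_sub h2]
    ring
  · have hge : ¬ (offsF n M y ν : ℕ) < 2 * m := by omega
    have h3 : n ≤ 2 * m + (offsF n M y ν : ℕ) := by omega
    rw [if_neg hge, hb, map_sub, upHom_one]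
    push_cast [Nat.cast_sub h2, Nat.cast_sub h3]
    ring

/-- the cube coordinate of a near-vertex site is never the last layer (`r + 2 ≤ 2m`), so its forward bonds are charted too. [folklore] -/
theorem vtxIdx_ne_last {m : ℕ} (h4m : 4 * m ≤ n) {n₀ : ℕ} (hn₀ : 4 * m = n₀ + 1) {r : ℕ} (hr : r + 2 ≤ 2 * m)
    {β' : Tor M} {y : Tor (fine n M)} (hy : NearVtx n M r β' y) (ν : Fin d) :
    vtxIdx n M m hn₀ y ν ≠ Fin.last n₀ := by
  intro h
  have hv := congrArg Fin.val h
  simp only [vtxIdx, Fin.val_last] at hv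
  have hoff := (offsF n M y ν).isLt
  rcases hy ν with ⟨_, ho⟩ | ⟨_, ho⟩
  · have hlt : (offsF n M y ν : ℕ) < 2 * m := by omega
    rw [if_pos hlt] at hv
    omega
  · have hge : ¬ (offsF n M y ν : ℕ) < 2 * m := by omega
    rw [if_neg hge] at hv
    omega

end Chart

/-! ## The END: local energy near a vertex ≤ the charted Dirichlet form -/

section Sum

variable {n M}

/-- reindexing: a sum of a non-negative function over the near-vertex sites is at most its sum over the charted cube minus the last
`ν`-layer. [folklore] -/
theorem sum_nearVtx_le_sum_chart {m K : ℕ} (hmK : m ≤ K) (h4m : 4 * m ≤ n) {n₀ : ℕ} (hn₀ : 4 * m = n₀ + 1) {r : ℕ} (hr : r + 2 ≤ 2 * m)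
    (β' : Tor M) [DecidablePred (NearVtx n M r β')] (ν : Fin d) {G : Tor (fine n M) → ℝ} (hG : ∀ x, 0 ≤ G x) :
    ∑ x, (if NearVtx n M r β' x then G x else 0)
      ≤ ∑ j ∈ univ.filter (fun j : Fin d → Fin (n₀ + 1) => j ν ≠ Fin.last n₀), G (chart (fine n M) (vtxBase n M m K β') j) := by
  classical
  have hN' : ∀ lam, n₀ + 1 ≤ fine n M lam := fun lam => by
    have h1 : 1 ≤ M lam := Nat.one_le_iff_ne_zero.mpr (NeZero.ne _)
    have : n ≤ fine n M lam := by unfold fine; exact Nat.le_mul_of_pos_right n h1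
    omega
  rw [← Finset.sum_filter]
  rw [← Finset.sum_image (f := fun x => G x) (s := univ.filter (fun j : Fin d → Fin (n₀ + 1) => j ν ≠ Fin.last n₀))
    (fun j _ j' _ h => chart_injective (fine n M) _ hN' h)]
  refine Finset.sum_le_sum_of_subset_of_nonneg ?_ fun x _ _ => hG x
  intro x hx
  rw [mem_filter] at hx
  rw [mem_image]
  exact ⟨vtxIdx n M m hn₀ x, mem_filter.mpr ⟨mem_univ _, vtxIdx_ne_last h4m hn₀ hr hx.2 ν⟩,
    chart_vtxIdx hmK h4m hn₀ (by omega) hx.2⟩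

/-- **THE END.**  For every field `z`, vertex `β′`, radius `r` with `r + 2 ≤ 2m`, `m ≤ K`, `4m = n₀ + 1 ≤ n`:
`Σ_ν Σ_{x : NearVtx r β′ x} ‖(∂_ν z)(x)‖² ≤ n²·dirOn univ (z ∘ chart (vtxBase m K β′))`. [folklore] -/
theorem sum_nearVtx_le_dirOn {m K : ℕ} (hmK : m ≤ K) (h4m : 4 * m ≤ n) {n₀ : ℕ} (hn₀ : 4 * m = n₀ + 1) {r : ℕ} (hr : r + 2 ≤ 2 * m)
    (β' : Tor M) [DecidablePred (NearVtx n M r β')] (z : Tor (fine n M) → ℂ) :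
    ∑ ν : Fin d, ∑ x, (if NearVtx n M r β' x then ‖(sdiff (fine n M) (n : ℂ) ν *ᵥ z) x‖ ^ 2 else 0)
      ≤ (n : ℝ) ^ 2 * dirOn (univ : Finset (Fin d → Fin (n₀ + 1))) (z ∘ chart (fine n M) (n := n₀) (vtxBase n M m K β')) := by
  rw [normSq_mul_dirOn_eq]
  exact Finset.sum_le_sum fun ν _ => sum_nearVtx_le_sum_chart hmK h4m hn₀ hr β' ν (fun _ => sq_nonneg _)

end Sum

end Summit.QuantumFields.BalabanUV.T4Continuum.DirichletVertexCubes

end
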